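import Mathlib
import HarnessLib
import Summits.NavierStokesRegularity.NavierStokesRegularity.Theorems.PoloidalWindowDoorPoloidalWindowRigidityUntwistedSeparation

/-!
# Route `PoloidalWindowDoor`, crux `PoloidalWindowRigidity` (K2, stmt-NavierStokesRegularity-19708), skeleton `lrc-jet` v5,
# stub `stub_untwisted` — brick F3b: BRANCH 2a OF THE SEPARATION (the dynamic identity differentiated along the height: where its
# height-Wronskian `D₃` is non-zero, `|∇ₕw|²` and `Δₕw` are LEAFWISE)

Cell ns-regularity-ideate, K2 lead ns-poloidal-K2-p1 (gen 6; `--supports stmt-NavierStokesRegularity-19708`, helper toward the registered stub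
`stub_untwisted`; paper proof `Cruxes/PoloidalWindowRigidity/UNTWISTED-NOTE.md` §3 (2a); CAS kit j283576/j283927).  Pure calculus, sequel of
`…UntwistedSeparation` (brick F3a: the vertical-line calculus and Branch 1).

Setting as in F3a (`w` untwisted on the open `U`: `∂₂w = P(w,y₂)`; `E = |∇ₕw|²`, `M = Δₕw`; leafwise divergence identity
`Λ·M + Λ_w·E + c = 0`), plus the DYNAMIC identity of a poloidal Navier–Stokes germ in structure-function currency (UNTWISTED-NOTE §1 (V0)), which on
an untwisted germ reads `(1−Λ)·S = (1−Λ)·M − Λ_w·E + k(w,y₂)` for the scalar `S := vₕ·∇ₕw + ∂ₜw` and SOME leafwise `k`, together with the transport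
rule `∂₂S = P_w·S + Λ·E + p_t(w,y₂)` (from `∂₂vₕ = Λ∇ₕw`, `∂₂(∂_bw) = P_w∂_bw`, `∂₂∂ₜw = ∂ₜP`).  Here `S, k, p_t` are abstract: the file never sees `v`.

* `dyn_combination` — eliminating `M`: **`Λ(1−Λ)·S + Λ_w·E + ((1−Λ)c − Λk) = 0`** on `U` (no division).
* `vert_deriv_dynIdentity` — its height-derivative: `(Ṅ + N P_w)·S + (NΛ + Λ̇_w + 2Λ_wP_w)·E + (N p_t + ṁ) = 0`, `N := Λ(1−Λ)`, `m := (1−Λ)c − Λk`,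
  `ġ := Dg(w,y₂)(P,1)`.
* `leafwise_of_dynWronskian_ne_zero` — **BRANCH 2a (Cramer):** where `D₃ := N(NΛ + Λ̇_w + 2Λ_wP_w) − Λ_w(Ṅ + NP_w) ≠ 0`, `E = a(w,y₂)` and
  `M = b(w,y₂)` (isoparametric leaves).  (`D₃ = N²κ` with the note's `κ = Λ + ∂_w[Λ̇/(Λ(1−Λ))]`; on the (TH) stratum `Λ_w ≡ 0` one has `D₃ = N²Λ ≠ 0`
  EVERYWHERE, so (TH) ∩ untwisted needs neither Branch 1 nor Branch 2b.)

With F3a: an untwisted non-degenerate germ has isoparametric leaves near every point where `D₁ ≠ 0` or `D₃ ≠ 0`; the complement `D₁ ≡ D₃ ≡ 0` on an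
open set is Branch 2b (empty; sequel F4).  WHAT THIS IS NOT: not a claim about Navier–Stokes regularity and not the stub — calculus bookkeeping
(bears_on LADDER-NS N0 via crux K2 = stmt-19708).
-/

noncomputable section

-- the summit and its single sub-problem share the name (CONVENTIONS §1), as in every Theorems file
set_option linter.dupNamespace false

namespace Summit.NavierStokesRegularity.NavierStokesRegularity.Theorems.PoloidalWindowDoorPoloidalWindowRigidityUntwistedSeparation2

open Set Function Filter Topology
open Summit.NavierStokesRegularity.NavierStokesRegularity.Theorems.PoloidalWindowDoorPoloidalWindowRigidityConstantShearMeans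
open Summit.NavierStokesRegularity.NavierStokesRegularity.Theorems.PoloidalWindowDoorLrcModEntireLeafwiseVertical
open Summit.NavierStokesRegularity.NavierStokesRegularity.Theorems.PoloidalWindowDoorPoloidalWindowRigidityUntwistedSeparation

variable {w S : EuclideanSpace ℝ (Fin 3) → ℝ} {P Λ c k pt : ℝ × ℝ → ℝ} {U : Set (EuclideanSpace ℝ (Fin 3))}

/-- **Eliminating `M` between the divergence identity and the dynamic identity**: from `Λ·M + Λ_w·E + c = 0` and
`(1−Λ)·S = (1−Λ)·M − Λ_w·E + k` one gets `Λ(1−Λ)·S + Λ_w·E + ((1−Λ)c − Λk) = 0` (pure algebra, pointwise). [folklore] -/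
theorem dyn_combination
    (hK1 : ∀ y ∈ U, Λ (w y, y 2) *
        (fderiv ℝ (fun y' => fderiv ℝ w y' (EuclideanSpace.single 0 (1 : ℝ))) y (EuclideanSpace.single 0 (1 : ℝ)) +
          fderiv ℝ (fun y' => fderiv ℝ w y' (EuclideanSpace.single 1 (1 : ℝ))) y (EuclideanSpace.single 1 (1 : ℝ))) +
      fderiv ℝ Λ (w y, y 2) (1, 0) *
        (fderiv ℝ w y (EuclideanSpace.single 0 (1 : ℝ)) ^ 2 + fderiv ℝ w y (EuclideanSpace.single 1 (1 : ℝ)) ^ 2) + c (w y, y 2) = 0)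
    (hV0 : ∀ y ∈ U, (1 - Λ (w y, y 2)) * S y = (1 - Λ (w y, y 2)) *
        (fderiv ℝ (fun y' => fderiv ℝ w y' (EuclideanSpace.single 0 (1 : ℝ))) y (EuclideanSpace.single 0 (1 : ℝ)) +
          fderiv ℝ (fun y' => fderiv ℝ w y' (EuclideanSpace.single 1 (1 : ℝ))) y (EuclideanSpace.single 1 (1 : ℝ))) -
      fderiv ℝ Λ (w y, y 2) (1, 0) *
        (fderiv ℝ w y (EuclideanSpace.single 0 (1 : ℝ)) ^ 2 + fderiv ℝ w y (EuclideanSpace.single 1 (1 : ℝ)) ^ 2) + k (w y, y 2))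
    {y : EuclideanSpace ℝ (Fin 3)} (hy : y ∈ U) :
    Λ (w y, y 2) * (1 - Λ (w y, y 2)) * S y +
      fderiv ℝ Λ (w y, y 2) (1, 0) *
        (fderiv ℝ w y (EuclideanSpace.single 0 (1 : ℝ)) ^ 2 + fderiv ℝ w y (EuclideanSpace.single 1 (1 : ℝ)) ^ 2) +
      ((1 - Λ (w y, y 2)) * c (w y, y 2) - Λ (w y, y 2) * k (w y, y 2)) = 0 := by
  have h1 := hK1 y hy
  have h2 := hV0 y hy
  linear_combination (1 - Λ (w y, y 2)) * h1 + Λ (w y, y 2) * h2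

/-- **The height-derivative of the combined dynamic identity.**  If on the open `U` the `C²` function `w` is untwisted (`∂₂w = P(w,y₂)`),
`S` is differentiable with the transport rule `∂₂S = P_w·S + Λ·E + p_t(w,y₂)`, and `N·S + Λ_w·E + m = 0` with `N := Λ(1−Λ)`, `m := (1−Λ)c − Λk`,
then `(Ṅ + N P_w)·S + (NΛ + Λ̇_w + 2Λ_w P_w)·E + (N p_t + ṁ) = 0` on `U` (`ġ = Dg(w,y₂)(P,1)`; here `Ṅ = (1−2Λ)Λ̇`, `ṁ = −Λ̇c + (1−Λ)ċ − Λ̇k − Λk̇`).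
[folklore] -/
theorem vert_deriv_dynIdentity (hU : IsOpen U) (hw : ContDiff ℝ 2 w)
    (hPd : ∀ y ∈ U, DifferentiableAt ℝ P (w y, y 2)) (hΛd : ∀ y ∈ U, ContDiffAt ℝ 2 Λ (w y, y 2))
    (hcd : ∀ y ∈ U, DifferentiableAt ℝ c (w y, y 2)) (hkd : ∀ y ∈ U, DifferentiableAt ℝ k (w y, y 2))
    (hSd : ∀ y ∈ U, DifferentiableAt ℝ S y)
    (hP : ∀ y ∈ U, fderiv ℝ w y (EuclideanSpace.single 2 (1 : ℝ)) = P (w y, y 2))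
    (hSz : ∀ y ∈ U, fderiv ℝ S y (EuclideanSpace.single 2 (1 : ℝ)) =
      fderiv ℝ P (w y, y 2) (1, 0) * S y + Λ (w y, y 2) *
        (fderiv ℝ w y (EuclideanSpace.single 0 (1 : ℝ)) ^ 2 + fderiv ℝ w y (EuclideanSpace.single 1 (1 : ℝ)) ^ 2) + pt (w y, y 2))
    (hcomb : ∀ y ∈ U, Λ (w y, y 2) * (1 - Λ (w y, y 2)) * S y +
      fderiv ℝ Λ (w y, y 2) (1, 0) *
        (fderiv ℝ w y (EuclideanSpace.single 0 (1 : ℝ)) ^ 2 + fderiv ℝ w y (EuclideanSpace.single 1 (1 : ℝ)) ^ 2) +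
      ((1 - Λ (w y, y 2)) * c (w y, y 2) - Λ (w y, y 2) * k (w y, y 2)) = 0)
    {y : EuclideanSpace ℝ (Fin 3)} (hy : y ∈ U) :
    ((1 - 2 * Λ (w y, y 2)) * fderiv ℝ Λ (w y, y 2) (P (w y, y 2), 1) +
        Λ (w y, y 2) * (1 - Λ (w y, y 2)) * fderiv ℝ P (w y, y 2) (1, 0)) * S y +
      (Λ (w y, y 2) * (1 - Λ (w y, y 2)) * Λ (w y, y 2) +
          fderiv ℝ (fun q => fderiv ℝ Λ q ((1 : ℝ), (0 : ℝ))) (w y, y 2) (P (w y, y 2), 1) +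
          2 * fderiv ℝ Λ (w y, y 2) (1, 0) * fderiv ℝ P (w y, y 2) (1, 0)) *
        (fderiv ℝ w y (EuclideanSpace.single 0 (1 : ℝ)) ^ 2 + fderiv ℝ w y (EuclideanSpace.single 1 (1 : ℝ)) ^ 2) +
      (Λ (w y, y 2) * (1 - Λ (w y, y 2)) * pt (w y, y 2) +
        (-(fderiv ℝ Λ (w y, y 2) (P (w y, y 2), 1)) * c (w y, y 2) + (1 - Λ (w y, y 2)) * fderiv ℝ c (w y, y 2) (P (w y, y 2), 1) -
          fderiv ℝ Λ (w y, y 2) (P (w y, y 2), 1) * k (w y, y 2) - Λ (w y, y 2) * fderiv ℝ k (w y, y 2) (P (w y, y 2), 1))) = 0 := by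
  have hwd : Differentiable ℝ w := hw.differentiable (by norm_num)
  -- abbreviations
  set Ef : EuclideanSpace ℝ (Fin 3) → ℝ := fun y' => fderiv ℝ w y' (EuclideanSpace.single 0 (1 : ℝ)) ^ 2 +
    fderiv ℝ w y' (EuclideanSpace.single 1 (1 : ℝ)) ^ 2 with hEf
  set Nf : EuclideanSpace ℝ (Fin 3) → ℝ := fun y' => Λ (w y', y' 2) * (1 - Λ (w y', y' 2)) with hNf
  set Lwf : EuclideanSpace ℝ (Fin 3) → ℝ := fun y' => fderiv ℝ Λ (w y', y' 2) ((1 : ℝ), (0 : ℝ)) with hLwf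
  set mf : EuclideanSpace ℝ (Fin 3) → ℝ := fun y' => (1 - Λ (w y', y' 2)) * c (w y', y' 2) - Λ (w y', y' 2) * k (w y', y' 2) with hmf
  -- differentiability at `y`
  have hEd : DifferentiableAt ℝ Ef y :=
    ((differentiableAt_partial hw (EuclideanSpace.single 0 (1 : ℝ)) y).pow 2).add
      ((differentiableAt_partial hw (EuclideanSpace.single 1 (1 : ℝ)) y).pow 2)
  have hLd : DifferentiableAt ℝ (fun y' : EuclideanSpace ℝ (Fin 3) => Λ (w y', y' 2)) y :=
    differentiableAt_leaf_comp ((hΛd y hy).differentiableAt (by norm_num)) (hwd y)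
  have h1Ld : DifferentiableAt ℝ (fun y' : EuclideanSpace ℝ (Fin 3) => 1 - Λ (w y', y' 2)) y := (differentiableAt_const _).sub hLd
  have hNd : DifferentiableAt ℝ Nf y := hLd.mul h1Ld
  have hLwd : DifferentiableAt ℝ Lwf y := differentiableAt_leaf_comp (differentiableAt_wPartial (hΛd y hy)) (hwd y)
  have hcfd : DifferentiableAt ℝ (fun y' : EuclideanSpace ℝ (Fin 3) => c (w y', y' 2)) y := differentiableAt_leaf_comp (hcd y hy) (hwd y)
  have hkfd : DifferentiableAt ℝ (fun y' : EuclideanSpace ℝ (Fin 3) => k (w y', y' 2)) y := differentiableAt_leaf_comp (hkd y hy) (hwd y)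
  have hm1 : DifferentiableAt ℝ (fun y' : EuclideanSpace ℝ (Fin 3) => (1 - Λ (w y', y' 2)) * c (w y', y' 2)) y := h1Ld.mul hcfd
  have hm2 : DifferentiableAt ℝ (fun y' : EuclideanSpace ℝ (Fin 3) => Λ (w y', y' 2) * k (w y', y' 2)) y := hLd.mul hkfd
  have hmd : DifferentiableAt ℝ mf y := hm1.sub hm2
  -- the identity as a function vanishing on `U`
  set Φ : EuclideanSpace ℝ (Fin 3) → ℝ := fun y' => Nf y' * S y' + Lwf y' * Ef y' + mf y' with hΦ
  have hΦ0 : Φ =ᶠ[𝓝 y] fun _ => 0 := by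
    filter_upwards [hU.mem_nhds hy] with y' hy'
    simpa [hΦ, hNf, hEf, hLwf, hmf] using hcomb y' hy'
  have hD0 : fderiv ℝ Φ y (EuclideanSpace.single 2 (1 : ℝ)) = 0 := by
    rw [hΦ0.fderiv_eq, fderiv_fun_const]; rfl
  have hA1 : DifferentiableAt ℝ (fun y' : EuclideanSpace ℝ (Fin 3) => Nf y' * S y') y := hNd.mul (hSd y hy)
  have hA2 : DifferentiableAt ℝ (fun y' : EuclideanSpace ℝ (Fin 3) => Lwf y' * Ef y') y := hLwd.mul hEd
  have hA : DifferentiableAt ℝ (fun y' : EuclideanSpace ℝ (Fin 3) => Nf y' * S y' + Lwf y' * Ef y') y := hA1.add hA2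
  have hD1 : fderiv ℝ Φ y (EuclideanSpace.single 2 (1 : ℝ)) =
      (Nf y * fderiv ℝ S y (EuclideanSpace.single 2 (1 : ℝ)) + S y * fderiv ℝ Nf y (EuclideanSpace.single 2 (1 : ℝ))) +
        (Lwf y * fderiv ℝ Ef y (EuclideanSpace.single 2 (1 : ℝ)) + Ef y * fderiv ℝ Lwf y (EuclideanSpace.single 2 (1 : ℝ))) +
        fderiv ℝ mf y (EuclideanSpace.single 2 (1 : ℝ)) := by
    rw [hΦ, fderiv_fun_add hA hmd, fderiv_fun_add hA1 hA2]
    simp only [_root_.add_apply]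
    rw [fderiv_mul_apply hNd (hSd y hy), fderiv_mul_apply hLwd hEd]
  -- the pieces
  have hL' : fderiv ℝ (fun y' : EuclideanSpace ℝ (Fin 3) => Λ (w y', y' 2)) y (EuclideanSpace.single 2 (1 : ℝ)) =
      fderiv ℝ Λ (w y, y 2) (P (w y, y 2), 1) := by
    rw [fderiv_leaf_comp_vertical ((hΛd y hy).differentiableAt (by norm_num)) (hwd y), hP y hy]
  have h1L' : fderiv ℝ (fun y' : EuclideanSpace ℝ (Fin 3) => 1 - Λ (w y', y' 2)) y (EuclideanSpace.single 2 (1 : ℝ)) =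
      -fderiv ℝ Λ (w y, y 2) (P (w y, y 2), 1) := by
    rw [fderiv_const_sub, neg_apply, hL']
  have hN' : fderiv ℝ Nf y (EuclideanSpace.single 2 (1 : ℝ)) = (1 - 2 * Λ (w y, y 2)) * fderiv ℝ Λ (w y, y 2) (P (w y, y 2), 1) := by
    rw [hNf, fderiv_mul_apply hLd h1Ld, hL', h1L']
    ring
  have hE' : fderiv ℝ Ef y (EuclideanSpace.single 2 (1 : ℝ)) = 2 * fderiv ℝ P (w y, y 2) (1, 0) * Ef y := by
    rw [hEf]; exact fderiv_vert_gradSq hU hw hPd hP hy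
  have hLw' : fderiv ℝ Lwf y (EuclideanSpace.single 2 (1 : ℝ)) =
      fderiv ℝ (fun q => fderiv ℝ Λ q ((1 : ℝ), (0 : ℝ))) (w y, y 2) (P (w y, y 2), 1) := by
    rw [hLwf, fderiv_leaf_comp_vertical (differentiableAt_wPartial (hΛd y hy)) (hwd y), hP y hy]
  have hc' : fderiv ℝ (fun y' : EuclideanSpace ℝ (Fin 3) => c (w y', y' 2)) y (EuclideanSpace.single 2 (1 : ℝ)) =
      fderiv ℝ c (w y, y 2) (P (w y, y 2), 1) := by
    rw [fderiv_leaf_comp_vertical (hcd y hy) (hwd y), hP y hy]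
  have hk' : fderiv ℝ (fun y' : EuclideanSpace ℝ (Fin 3) => k (w y', y' 2)) y (EuclideanSpace.single 2 (1 : ℝ)) =
      fderiv ℝ k (w y, y 2) (P (w y, y 2), 1) := by
    rw [fderiv_leaf_comp_vertical (hkd y hy) (hwd y), hP y hy]
  have hm' : fderiv ℝ mf y (EuclideanSpace.single 2 (1 : ℝ)) =
      -(fderiv ℝ Λ (w y, y 2) (P (w y, y 2), 1)) * c (w y, y 2) + (1 - Λ (w y, y 2)) * fderiv ℝ c (w y, y 2) (P (w y, y 2), 1) -
        fderiv ℝ Λ (w y, y 2) (P (w y, y 2), 1) * k (w y, y 2) - Λ (w y, y 2) * fderiv ℝ k (w y, y 2) (P (w y, y 2), 1) := by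
    rw [hmf, fderiv_fun_sub hm1 hm2]
    simp only [FunLike.coe_sub, Pi.sub_apply]
    rw [fderiv_mul_apply h1Ld hcfd, fderiv_mul_apply hLd hkfd, h1L', hc', hL', hk']
    ring
  rw [hD1, hSz y hy, hN', hE', hLw', hm'] at hD0
  have e1 : Nf y = Λ (w y, y 2) * (1 - Λ (w y, y 2)) := rfl
  have e2 : Lwf y = fderiv ℝ Λ (w y, y 2) ((1 : ℝ), (0 : ℝ)) := rfl
  have e3 : Ef y = fderiv ℝ w y (EuclideanSpace.single 0 (1 : ℝ)) ^ 2 + fderiv ℝ w y (EuclideanSpace.single 1 (1 : ℝ)) ^ 2 := rfl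
  rw [e1, e2, e3] at hD0
  linear_combination hD0

/-- **BRANCH 2a OF THE SEPARATION (Cramer on the dynamic pair).**  Under the hypotheses of `vert_deriv_dynIdentity` (with the combined identity
supplied by `dyn_combination`) and the divergence identity, there are functions `a, b : ℝ × ℝ → ℝ` of `(w,y₂)` such that at every point of `U` where
`D₃ := N(NΛ + Λ̇_w + 2Λ_wP_w) − Λ_w(Ṅ + NP_w) ≠ 0` (`N = Λ(1−Λ)`; `D₃ = N²κ` in UNTWISTED-NOTE's notation) one has `E = a(w,y₂)` and, if also
`Λ ≠ 0` there, `M = b(w,y₂)`: isoparametric leaves. [folklore] -/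
theorem leafwise_of_dynWronskian_ne_zero (hU : IsOpen U) (hw : ContDiff ℝ 2 w)
    (hPd : ∀ y ∈ U, DifferentiableAt ℝ P (w y, y 2)) (hΛd : ∀ y ∈ U, ContDiffAt ℝ 2 Λ (w y, y 2))
    (hcd : ∀ y ∈ U, DifferentiableAt ℝ c (w y, y 2)) (hkd : ∀ y ∈ U, DifferentiableAt ℝ k (w y, y 2))
    (hSd : ∀ y ∈ U, DifferentiableAt ℝ S y)
    (hP : ∀ y ∈ U, fderiv ℝ w y (EuclideanSpace.single 2 (1 : ℝ)) = P (w y, y 2))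
    (hSz : ∀ y ∈ U, fderiv ℝ S y (EuclideanSpace.single 2 (1 : ℝ)) =
      fderiv ℝ P (w y, y 2) (1, 0) * S y + Λ (w y, y 2) *
        (fderiv ℝ w y (EuclideanSpace.single 0 (1 : ℝ)) ^ 2 + fderiv ℝ w y (EuclideanSpace.single 1 (1 : ℝ)) ^ 2) + pt (w y, y 2))
    (hK1 : ∀ y ∈ U, Λ (w y, y 2) *
        (fderiv ℝ (fun y' => fderiv ℝ w y' (EuclideanSpace.single 0 (1 : ℝ))) y (EuclideanSpace.single 0 (1 : ℝ)) +
          fderiv ℝ (fun y' => fderiv ℝ w y' (EuclideanSpace.single 1 (1 : ℝ))) y (EuclideanSpace.single 1 (1 : ℝ))) +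
      fderiv ℝ Λ (w y, y 2) (1, 0) *
        (fderiv ℝ w y (EuclideanSpace.single 0 (1 : ℝ)) ^ 2 + fderiv ℝ w y (EuclideanSpace.single 1 (1 : ℝ)) ^ 2) + c (w y, y 2) = 0)
    (hV0 : ∀ y ∈ U, (1 - Λ (w y, y 2)) * S y = (1 - Λ (w y, y 2)) *
        (fderiv ℝ (fun y' => fderiv ℝ w y' (EuclideanSpace.single 0 (1 : ℝ))) y (EuclideanSpace.single 0 (1 : ℝ)) +
          fderiv ℝ (fun y' => fderiv ℝ w y' (EuclideanSpace.single 1 (1 : ℝ))) y (EuclideanSpace.single 1 (1 : ℝ))) -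
      fderiv ℝ Λ (w y, y 2) (1, 0) *
        (fderiv ℝ w y (EuclideanSpace.single 0 (1 : ℝ)) ^ 2 + fderiv ℝ w y (EuclideanSpace.single 1 (1 : ℝ)) ^ 2) + k (w y, y 2)) :
    ∃ a b : ℝ × ℝ → ℝ, ∀ y ∈ U,
      (Λ (w y, y 2) * (1 - Λ (w y, y 2))) *
            (Λ (w y, y 2) * (1 - Λ (w y, y 2)) * Λ (w y, y 2) +
              fderiv ℝ (fun q => fderiv ℝ Λ q ((1 : ℝ), (0 : ℝ))) (w y, y 2) (P (w y, y 2), 1) +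
              2 * fderiv ℝ Λ (w y, y 2) (1, 0) * fderiv ℝ P (w y, y 2) (1, 0)) -
          fderiv ℝ Λ (w y, y 2) (1, 0) *
            ((1 - 2 * Λ (w y, y 2)) * fderiv ℝ Λ (w y, y 2) (P (w y, y 2), 1) +
              Λ (w y, y 2) * (1 - Λ (w y, y 2)) * fderiv ℝ P (w y, y 2) (1, 0)) ≠ 0 →
        fderiv ℝ w y (EuclideanSpace.single 0 (1 : ℝ)) ^ 2 + fderiv ℝ w y (EuclideanSpace.single 1 (1 : ℝ)) ^ 2 = a (w y, y 2) ∧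
          (Λ (w y, y 2) ≠ 0 →
            fderiv ℝ (fun y' => fderiv ℝ w y' (EuclideanSpace.single 0 (1 : ℝ))) y (EuclideanSpace.single 0 (1 : ℝ)) +
              fderiv ℝ (fun y' => fderiv ℝ w y' (EuclideanSpace.single 1 (1 : ℝ))) y (EuclideanSpace.single 1 (1 : ℝ)) = b (w y, y 2)) := by
  -- Cramer formulas as functions of `p = (w, y₂)`
  set af : ℝ × ℝ → ℝ := fun p =>
    (-(Λ p * (1 - Λ p)) * (Λ p * (1 - Λ p) * pt p +
        (-(fderiv ℝ Λ p (P p, 1)) * c p + (1 - Λ p) * fderiv ℝ c p (P p, 1) - fderiv ℝ Λ p (P p, 1) * k p - Λ p * fderiv ℝ k p (P p, 1))) +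
      ((1 - 2 * Λ p) * fderiv ℝ Λ p (P p, 1) + Λ p * (1 - Λ p) * fderiv ℝ P p (1, 0)) * ((1 - Λ p) * c p - Λ p * k p)) /
    ((Λ p * (1 - Λ p)) * (Λ p * (1 - Λ p) * Λ p + fderiv ℝ (fun q => fderiv ℝ Λ q ((1 : ℝ), (0 : ℝ))) p (P p, 1) +
          2 * fderiv ℝ Λ p (1, 0) * fderiv ℝ P p (1, 0)) -
      fderiv ℝ Λ p (1, 0) * ((1 - 2 * Λ p) * fderiv ℝ Λ p (P p, 1) + Λ p * (1 - Λ p) * fderiv ℝ P p (1, 0))) with haf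
  refine ⟨af, fun p => -(fderiv ℝ Λ p (1, 0) * af p + c p) / Λ p, fun y hy hD => ?_⟩
  have h1 := dyn_combination hK1 hV0 hy
  have hcomb : ∀ y ∈ U, Λ (w y, y 2) * (1 - Λ (w y, y 2)) * S y +
      fderiv ℝ Λ (w y, y 2) (1, 0) *
        (fderiv ℝ w y (EuclideanSpace.single 0 (1 : ℝ)) ^ 2 + fderiv ℝ w y (EuclideanSpace.single 1 (1 : ℝ)) ^ 2) +
      ((1 - Λ (w y, y 2)) * c (w y, y 2) - Λ (w y, y 2) * k (w y, y 2)) = 0 := fun y' hy' => dyn_combination hK1 hV0 hy'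
  have h2 := vert_deriv_dynIdentity hU hw hPd hΛd hcd hkd hSd hP hSz hcomb hy
  -- scalars
  set L := Λ (w y, y 2) with hL
  set Lw := fderiv ℝ Λ (w y, y 2) (1, 0) with hLw
  set Ld := fderiv ℝ Λ (w y, y 2) (P (w y, y 2), 1) with hLd'
  set Lwd := fderiv ℝ (fun q => fderiv ℝ Λ q ((1 : ℝ), (0 : ℝ))) (w y, y 2) (P (w y, y 2), 1) with hLwd
  set Pw := fderiv ℝ P (w y, y 2) (1, 0) with hPw
  set cc := c (w y, y 2) with hcc
  set cd := fderiv ℝ c (w y, y 2) (P (w y, y 2), 1) with hcd'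
  set kk := k (w y, y 2) with hkk
  set kd := fderiv ℝ k (w y, y 2) (P (w y, y 2), 1) with hkd'
  set ptv := pt (w y, y 2) with hptv
  set Ev := fderiv ℝ w y (EuclideanSpace.single 0 (1 : ℝ)) ^ 2 + fderiv ℝ w y (EuclideanSpace.single 1 (1 : ℝ)) ^ 2 with hEv
  set Mv := fderiv ℝ (fun y' => fderiv ℝ w y' (EuclideanSpace.single 0 (1 : ℝ))) y (EuclideanSpace.single 0 (1 : ℝ)) +
    fderiv ℝ (fun y' => fderiv ℝ w y' (EuclideanSpace.single 1 (1 : ℝ))) y (EuclideanSpace.single 1 (1 : ℝ)) with hMv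
  -- the linear system:  N·S + Lw·E + m = 0,  A21·S + A22·E + m2 = 0
  set N := L * (1 - L) with hN
  set m := (1 - L) * cc - L * kk with hm
  set A21 := (1 - 2 * L) * Ld + L * (1 - L) * Pw with hA21
  set A22 := L * (1 - L) * L + Lwd + 2 * Lw * Pw with hA22
  set m2 := L * (1 - L) * ptv + (-Ld * cc + (1 - L) * cd - Ld * kk - L * kd) with hm2
  set D := N * A22 - Lw * A21 with hDdef
  have hD' : D ≠ 0 := hD
  have hEsol : Ev = (-N * m2 + A21 * m) / D := by
    rw [eq_div_iff hD']
    have : D * Ev = -N * m2 + A21 * m := by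
      rw [hDdef]; linear_combination (-A21) * h1 + N * h2
    linarith [this]
  have haf' : af (w y, y 2) = (-N * m2 + A21 * m) / D := by
    simp only [haf, hN, hm2, hA21, hm, hDdef, hA22, hL, hLw, hLd', hLwd, hPw, hcc, hcd', hkk, hkd', hptv]
  refine ⟨by rw [haf', hEsol], fun hL0 => ?_⟩
  -- `M` from the divergence identity
  have hK := hK1 y hy
  have hL0' : L ≠ 0 := hL0
  show Mv = -(Lw * af (w y, y 2) + cc) / L
  rw [eq_div_iff hL0', haf', ← hEsol]
  linear_combination hK

end Summit.NavierStokesRegularity.NavierStokesRegularity.Theorems.PoloidalWindowDoorPoloidalWindowRigidityUntwistedSeparation2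

end
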